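import Summits.BirchSwinnertonDyer.BirchSwinnertonDyer.Theorems.KatoDescentTamePotSupersingularTameUpperReducibleTorsionVoid
import Summits.BirchSwinnertonDyer.Rank1Residual.X11b.BDPRouteTamagawaSupport
import Literature.NumberTheory.EllipticCurves.GoodReductionTorsionReductionProofs
import Literature.NumberTheory.EllipticCurves.PadicFiltrationIndexProofs
import Literature.NumberTheory.EllipticCurves.RootNumberProofs
import HarnessLib

/-!
# Route `KatoDescentTamePotSupersingular` (rung K8, sub-rung B4 (t′), cell `bsd-potss`): on the ♯ ROWS of
# the Conj-A crux `TameFineSelmerCoatesSujatha` (item stmt-BirchSwinnertonDyer-19413: `p ∣ ∏_ℓ c_ℓ(E)`)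
# there is a bad prime `q ≠ p` with `E(ℚ_q)[p] ≠ 0` — the TYPED OBSTRUCTION to the printed residual
# criterion for Coates–Sujatha's (A) (Deo–Ray–Sujatha 2023, Thm. 3.8 (iii) / Thm. 3.9 (iii))
# (a `--supports … --as helper` file; seat `bsd-potss-k8t-c4` g3; nothing booked, BSD not proved by any of this)

WHAT AND WHY. After the Heegner road (p429560, re-homed p437730/p437915) the Conj-A crux 19413 is
load-bearing only on the ♯ rows: rank-`0` (t′) rows with `E[p]` irreducible, `ρ̄_{E,p}` not onto, no
CM, and `p ∣ ∏_ℓ c_ℓ(E)` (or no Manin-clean datum — census-empty). The only printed SUFFICIENT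
criteria for (A) = `μ(Y(E/ℚ^cyc)) = 0` beyond Coates–Sujatha's Thm. 3.4 (classical `μ = 0` of
`ℚ(E[p])^cyc`, unreachable: the image is non-abelian of prime-to-`p` order) are Deo–Ray–Sujatha,
*Pure Appl. Math. Q.* 19 (2023) no. 2, Thm. 3.7 (`H²(ℚ_S/ℚ, E[p]) = 0 ⇒ (A)`), Thm. 3.8 / 3.9 (its
class-group form, hypothesis (iii): "at each `v ∈ S`, `ρ̄|_{G_v}` has no trivial subrepresentation",
resp. "`E(κ_v)[p] = 0`") and §5 (dihedral `ρ̄`). This file proves IN THE KERNEL the local fact that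
voids hypothesis (iii) on EVERY ♯ row: **if `p ∣ ∏_ℓ c_ℓ(E)` and `p ∤ c_p(E)` then some bad prime
`q ≠ p` has a point of order `p` in `E(ℚ_q)`** — i.e. `H⁰(ℚ_q, E[p]) ≠ 0`; by local Tate duality and
the Poitou–Tate surjection `H²(ℚ_S/ℚ, E[p]) ↠ ⊕_{v ∈ S} H⁰(ℚ_v, E[p])^∨` (for irreducible `E[p]`,
`E[p]^* ≅ E[p]`) also `H²(ℚ_S/ℚ, E[p]) ≠ 0`, so Thm. 3.7's hypothesis fails too (this last step is
prose, [NSW] (8.6.10); not formalised here). On (t′) rows `p ∤ c_p` is a THEOREM of this seat (p436151: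
`c_p ≤ 4 < p` at an additive `p ≥ 5`; `c₃ = 2` on Kodaira III/III*), whence the row statement
`sharpRow_exists_local_pTorsion`.

* `exists_ne_zero_nsmul_eq_zero_padic_of_dvd_localTamagawaNumber` — for ANY globally minimal `E/ℚ`,
  primes `q ≠ p`: `p ∣ c_q(E) ⟹ ∃ P ∈ E(ℚ_q), P ≠ O, p•P = O` (`E(ℚ_q)[p] ≅ (E(ℚ_q)/E₁(ℚ_q))[p]`,
  the tree's `nonempty_kerEquiv_quotient_formalFiltration`, *AEC* VII.3.1(b) both halves; the quotient
  has order `c_q · #Ẽ_ns(𝔽_q)`, `index_formalFiltration`; Cauchy). Generalises the additive-only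
  `O5.dvd_localTamagawaNumber_iff_exists_of_addv` to every reduction type.
* `exists_prime_local_pTorsion_of_dvd_tamagawaProduct` — `p ∣ ∏_ℓ c_ℓ(E)`, `p ∤ c_p(E)` ⟹ a bad
  prime `q ≠ p` with `E(ℚ_q)[p] ≠ 0` (`tamagawaProduct_eq_prod` over the bad places,
  `Prime.exists_mem_finset_dvd`).
* `sharpRow_exists_local_pTorsion` — the same on every (t′) row at an odd `p` with `p ∣ ∏_ℓ c_ℓ(E)`.

Nothing about Conjecture A is asserted; the crux 19413 stays OPEN (open problem); this is the kernel
form of §2 (b) of the seat's FINDING-19982-U0-bill-v3 memo.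

References: [DeoRaySujatha2023] Thm. 3.7, Thm. 3.8, Thm. 3.9, §5 (arXiv:2202.09937, PAMQ 19 no. 2);
[CoatesSujatha2005] Conj. A, Thm. 3.4; [SilvermanAEC2009] VII.2.1, VII.3.1(b), VII.6.1;
[SilvermanATAEC1994] Cor. IV.9.2(d); [NSW2008] (8.6.10).
-/

set_option autoImplicit false
-- the Theorems directory repeats the summit name (sibling precedent `KatoDescentPotSupersingularAssembly.lean`)
set_option linter.dupNamespace false

noncomputable section

open scoped Classical NumberField

namespace Summit.BirchSwinnertonDyer.BirchSwinnertonDyer.Theorems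

open WeierstrassCurve IsDedekindDomain NumberField Rat.HeightOneSpectrum
  Literature.NumberTheory.EllipticCurves
  Literature.NumberTheory.EllipticCurves.Rank1Residual
  Literature.NumberTheory.EllipticCurves.Rank1Residual.Typed
  Summit.BirchSwinnertonDyer.Rank1Residual
  Summit.BirchSwinnertonDyer.Rank1Residual.Additive

/-! ## §1 `p ∣ c_q(E)`, `q ≠ p` ⟹ `E(ℚ_q)[p] ≠ 0` (any reduction type) -/

/-- **A prime `p ≠ q` dividing the local Tamagawa number `c_q(E)` yields a `ℚ_q`-point of order `p`**
(`W` globally minimal, so `W ⊗ ℚ_q` is `ℤ_q`-minimal): `[E(ℚ_q) : E₁(ℚ_q)] = c_q · #Ẽ_ns(𝔽_q)`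
(Silverman *AEC* VII.2.1 / VII.6.1, tree `index_formalFiltration`), so the finite quotient
`E(ℚ_q)/E₁(ℚ_q)` has an element of order `p` (Cauchy), and `E(ℚ_q)[p] ≅ (E(ℚ_q)/E₁(ℚ_q))[p]` for
`q ∤ p` (*AEC* VII.3.1(b) with its surjective half: `E₁(ℚ_q) ≅ Ê(qℤ_q)` is uniquely `p`-divisible;
tree `nonempty_kerEquiv_quotient_formalFiltration`). No hypothesis on the reduction type at `q`.
[cite: SilvermanAEC2009, VII.2 Prop. 2.1, VII.3 Prop. 3.1(b), VII.6 Thm. 6.1] -/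
theorem exists_ne_zero_nsmul_eq_zero_padic_of_dvd_localTamagawaNumber (W : WeierstrassCurve ℚ)
    [W.IsElliptic] [W.IsGloballyMinimal] (q p : ℕ) [hq : Fact q.Prime] (hp : p.Prime) (hqp : q ≠ p)
    (h : p ∣ (W.baseChange ℚ_[q]).localTamagawaNumber ℤ_[q]) :
    ∃ P : (W.baseChange ℚ_[q]).toAffine.Point, P ≠ 0 ∧ p • P = 0 := by
  haveI : (W.baseChange ℚ_[q]).IsElliptic := by rw [baseChange]; infer_instance
  haveI : Fact p.Prime := ⟨hp⟩
  set X := W.baseChange ℚ_[q] with hX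
  have hqp' : ¬ q ∣ p := fun hd ↦ hqp ((Nat.prime_dvd_prime_iff_eq hq.out hp).mp hd)
  -- `p ∣ [E(ℚ_q) : E₁(ℚ_q)] = c_q · #Ẽ_ns`
  have hidx : (X.formalFiltration 1).index =
      X.localTamagawaNumber ℤ_[q] * Nat.card (X.reduction ℤ_[q]).toAffine.Point := by
    rw [X.index_formalFiltration le_rfl, Nat.sub_self, pow_zero, mul_one]
  have hdvd : p ∣ Nat.card (X.toAffine.Point ⧸ X.formalFiltration 1) := by
    rw [← AddSubgroup.index_eq_card, hidx]
    exact dvd_mul_of_dvd_left h _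
  -- the quotient is finite (`E⁽²⁾` has finite index, `E⁽²⁾ ≤ E⁽¹⁾`)
  haveI : (X.formalFiltration 1).FiniteIndex := by
    haveI := X.finiteIndex_formalFiltration 2
    exact AddSubgroup.finiteIndex_of_le (X.formalFiltration_antitone (by norm_num : 1 ≤ 2))
  haveI : Finite (X.toAffine.Point ⧸ X.formalFiltration 1) :=
    AddSubgroup.finite_quotient_of_finiteIndex
  -- an element of order `p` in the quotient
  obtain ⟨x, hx⟩ := exists_prime_addOrderOf_dvd_card' (G := X.toAffine.Point ⧸ X.formalFiltration 1)
    p hdvd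
  have hx0 : x ≠ 0 := by
    intro h0
    rw [h0, addOrderOf_zero] at hx
    exact hp.one_lt.ne' hx.symm
  have hpx : (p : ℤ) • x = 0 := by
    rw [natCast_zsmul, ← hx]
    exact addOrderOf_nsmul_eq_zero x
  -- transport to `E(ℚ_q)[p]`
  obtain ⟨e⟩ := X.nonempty_kerEquiv_quotient_formalFiltration hqp'
  set y : (zsmulAddGroupHom (p : ℤ) : (X.toAffine.Point ⧸ X.formalFiltration 1) →+ _).ker :=
    ⟨x, by simp [AddMonoidHom.mem_ker, hpx]⟩ with hy
  refine ⟨(e.symm y : X.toAffine.Point), ?_, ?_⟩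
  · intro h0
    apply hx0
    have : e.symm y = 0 := Subtype.ext h0
    have : y = 0 := by simpa using congrArg e this
    exact congrArg Subtype.val this
  · have hmem := (e.symm y).2
    rw [AddMonoidHom.mem_ker] at hmem
    rw [← natCast_zsmul]
    exact hmem

/-! ## §2 `p ∣ ∏_ℓ c_ℓ(E)`, `p ∤ c_p(E)` ⟹ a bad prime `q ≠ p` with `E(ℚ_q)[p] ≠ 0` -/

/-- **If `p ∣ ∏_ℓ c_ℓ(E)` but `p ∤ c_p(E)`, some prime `q ≠ p` of bad reduction carries a
`ℚ_q`-point of order `p`**: the Tamagawa product is the finite product of the `c_q` over the bad places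
(`tamagawaProduct_eq_prod`), the prime `p` divides one factor `c_q` (`Prime.exists_mem_finset_dvd`),
`q ≠ p` by hypothesis, `q` is bad since `c_q ≠ 1`, and §1 applies. So hypothesis (iii) of
Deo–Ray–Sujatha's Thm. 3.8 / 3.9 ("no trivial subrepresentation of `ρ̄|_{G_v}`", resp.
"`E(κ_v)[p] = 0`", at every `v ∈ S ⊇ {bad primes}`) FAILS at `v = q`.
[cite: DeoRaySujatha2023, Thm. 3.8 (iii) and Thm. 3.9 (iii)] [cite: SilvermanAEC2009, VII.3 Prop. 3.1(b), VII.6 Thm. 6.1] -/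
theorem exists_prime_local_pTorsion_of_dvd_tamagawaProduct (W : WeierstrassCurve ℚ) [W.IsElliptic]
    [W.IsGloballyMinimal] {p : ℕ} [hpf : Fact p.Prime] (h : p ∣ W.tamagawaProduct)
    (hcp : ¬ p ∣ (W.baseChange ℚ_[p]).localTamagawaNumber ℤ_[p]) :
    ∃ (q : ℕ) (_ : Fact q.Prime), q ≠ p ∧ ¬ W.HasGoodReductionAtPrime q ∧
      ∃ P : (W.baseChange ℚ_[q]).toAffine.Point, P ≠ 0 ∧ p • P = 0 := by
  have hp : p.Prime := hpf.out
  have hfW : (W.badPlaces ℤ).Finite := W.finite_badPlaces_holds ℤ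
  set s : Finset (HeightOneSpectrum ℤ) := hfW.toFinset with hsdef
  have hsW : ∀ w, ¬ W.HasGoodReductionAt w → w ∈ s := fun w hw ↦ by
    rw [hsdef, Set.Finite.mem_toFinset, mem_badPlaces_iff]; exact hw
  rw [tamagawaProduct_eq_prod W s hsW] at h
  obtain ⟨v, hv, hdv⟩ := hp.prime.exists_mem_finset_dvd h
  haveI := Fact.mk (primesEquiv v).2
  -- `q := primesEquiv v ≠ p`
  have hqp : (primesEquiv v : ℕ) ≠ p := by
    intro hq
    have key : ∀ (q : ℕ) (hq : Fact q.Prime), (primesEquiv v : ℕ) = q →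
        p ∣ @WeierstrassCurve.localTamagawaNumber ℤ_[q] _ _ _ ℚ_[q] _ _ _ (W.baseChange ℚ_[q]) := by
      rintro q hq' rfl
      exact hdv
    exact hcp (key p hpf hq)
  -- `v` is a bad place, i.e. `q` is a bad prime
  have hbad : ¬ W.HasGoodReductionAt v := by
    rw [hsdef, Set.Finite.mem_toFinset, mem_badPlaces_iff] at hv; exact hv
  refine ⟨(primesEquiv v : ℕ), inferInstance, hqp, ?_,
    exists_ne_zero_nsmul_eq_zero_padic_of_dvd_localTamagawaNumber W _ p hp hqp hdv⟩
  intro hgood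
  exact hbad ((WeierstrassCurve.hasGoodReductionAtPrime_primesEquiv_iff_hasGoodReductionAt W v).mp hgood)

/-! ## §3 The ♯ rows of the Conj-A crux: a bad `q ≠ p` with `E(ℚ_q)[p] ≠ 0` -/

/-- **On every (t′) row at an odd `p` with `p ∣ ∏_ℓ c_ℓ(E)` (the ♯ rows of crux 19413) there is a
bad prime `q ≠ p` with a `ℚ_q`-point of order `p`** — `p ∤ c_p` on (t′) rows (this seat's
`not_dvd_localTamagawaNumber_padic_of_addv_of_five_le`: `c_p ≤ 4 < p` at an additive `p ≥ 5`;
`not_three_dvd_localTamagawaNumber_padic_of_condExpTwo_three`: `c₃ ∈ {1,2,4}` on the tame types) and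
§2. Hence Deo–Ray–Sujatha's residual criterion for Coates–Sujatha's (A) (Thm. 3.7 via 3.8 / 3.9 /
§5) is VOID on the ♯ rows: its local hypothesis fails at `q` (and `H²(ℚ_S/ℚ, E[p]) ≠ 0` by
Poitou–Tate) — the Tamagawa defect that makes a row ♯ is exactly what kills the criterion. A typed
obstruction; the crux stays OPEN; nothing about (A) is asserted.
[cite: DeoRaySujatha2023, Thm. 3.7, Thm. 3.8 (iii), Thm. 3.9 (iii)] [cite: CoatesSujatha2005, Conjecture A]
[cite: SilvermanATAEC1994, Cor. IV.9.2(d) and IV.9.4 Table 4.1] -/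
theorem sharpRow_exists_local_pTorsion (W : WeierstrassCurve ℚ) [W.IsElliptic] [W.IsGloballyMinimal]
    (p : ℕ) [Fact p.Prime] (hp2 : p ≠ 2) (hadd : Addv W p) (hT : SubTprime W p)
    (h : p ∣ W.tamagawaProduct) :
    ∃ (q : ℕ) (_ : Fact q.Prime), q ≠ p ∧ ¬ W.HasGoodReductionAtPrime q ∧
      ∃ P : (W.baseChange ℚ_[q]).toAffine.Point, P ≠ 0 ∧ p • P = 0 := by
  refine exists_prime_local_pTorsion_of_dvd_tamagawaProduct W h ?_
  by_cases h3 : p = 3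
  · subst h3
    exact not_three_dvd_localTamagawaNumber_padic_of_condExpTwo_three W hadd hT.2.1
  · have hp : p.Prime := Fact.out
    have h5 : 5 ≤ p := by
      rcases Nat.lt_or_ge p 5 with hlt | hge
      · have h2le := hp.two_le
        interval_cases p
        · exact absurd rfl hp2
        · exact absurd rfl h3
        · exact absurd hp (by decide)
      · exact hge
    exact not_dvd_localTamagawaNumber_padic_of_addv_of_five_le W p h5 hadd

end Summit.BirchSwinnertonDyer.BirchSwinnertonDyer.Theorems

end
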